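import Literature.Probability.RandomPlanarGeometry.HexSAWSurfaceWallRenewalNinthCensusIdentity
import Literature.Probability.RandomPlanarGeometry.HexSAWSurfaceWallRenewalCensusNineB
import HarnessLib

/-!
# The ninth-order coefficient of `β(y)²` is exactly fifteen:
# `y⁸ (β(y)² − y − 1/y − 1/y² − 2/y³ − 4/y⁴ − 6/y⁵ − 12/y⁶ − 18/y⁷) → 15`

`β(y) = wallRate y` is the exponential growth rate of wall bridges of self-avoiding walks on the brick-wall (hexagonal) lattice along a zigzag wall with
contact fugacity `y`.  «NINTH-CENSUS-IDENTITY» (`HexSAWSurfaceWallRenewalNinthCensusIdentity`) proved that the ninth coefficient of the strong-adsorption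
expansion exists and equals `N₁₀,₁ + N₁₁,₂ + N₁₂,₃ + N₁₃,₄ − 695`, the four class numbers of the diagonal `s − v = 9` of the wall-renewal census being symbolic.
This module substitutes the kernel-certified values — `N₁₀,₁ = 267` («CENSUS-NINE-A», a-p6 g20) and `N₁₁,₂ = 295`, `N₁₂,₃ = 132`, `N₁₃,₄ = 16` («CENSUS-NINE-B»,
by the verified counting engine «CENSUS-ENGINE» of this seat):

  ★★★ `tendsto_pow_eight_mul_wallRate_sq_sub : y⁸ (β(y)² − y − 1/y − 1/y² − 2/y³ − 4/y⁴ − 6/y⁵ − 12/y⁶ − 18/y⁷) → 15` (`y → ∞`),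

i.e. **`β(y)² = y + 1/y + 1/y² + 2/y³ + 4/y⁴ + 6/y⁵ + 12/y⁶ + 18/y⁷ + 15/y⁸ + o(y⁻⁸)`** (`isLittleO_wallRate_sq_sub_ninth`, `eventually_ninth_order_window`,
`tendsto_pow_eight_mul_wallRate_sq_sub_unique`) — a-idea-1 g30–g34's fibre-programme prediction `a₈ = 15` (quoted in «A7-EXACT») is a THEOREM; the coefficient
sequence `1, 1, 2, 4, 6, 12, 18, 15` is NOT monotone.

HONEST LABEL.  LANE THEOREM, DERIVED (one-line assembly of the landed inputs); NEW IN WRITING (modest): the coefficient is computed in this lane, print has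
`β ∼ √y` only ([BeatonBousquetMelouDeGierDuminilCopinGuttmann2014, §3.1, Proposition 5, p. 10]) and the renewal structure ([MadrasSlade1993, §4.2], [Kesten1963SAW, §4]).
NOT CLAIMED: `a₉` (needs the diagonal `s − v = 10`: data `738 / 860 / 468 / 95 / 1` by the engine's replica, not certified here), any rate, `m₉ / V₉ / d₉`, anything
for `y ≤ μ³`.  No definitions.
-/

namespace Literature.Probability.RandomPlanarGeometry.SAW.HexBW.Wall

open Finset Filter Function
open Literature.Probability.LatticeModels
open _root_.Topology Asymptotics

variable {y : ℝ}

/-- [folklore] Relabel the limit of a `Tendsto` by an equal constant. -/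
private theorem tendsto_of_tendsto_of_eq_nx {f : ℝ → ℝ} {L c : ℝ} (h : Tendsto f atTop (𝓝 L)) (e : L = c) :
    Tendsto f atTop (𝓝 c) := e ▸ h

/-- ★★★ **THE NINTH-ORDER COEFFICIENT OF `β(y)²` IS EXACTLY FIFTEEN:**
`y⁸ (β(y)² − y − 1/y − 1/y² − 2/y³ − 4/y⁴ − 6/y⁵ − 12/y⁶ − 18/y⁷) → 15` as `y → ∞` — the census identity with `N₁₀,₁ = 267`, `N₁₁,₂ = 295`, `N₁₂,₃ = 132`,
`N₁₃,₄ = 16`: `267 + 295 + 132 + 16 − 695 = 15`. [cite: BeatonBousquetMelouDeGierDuminilCopinGuttmann2014, Section 3.1, Proposition 5 (arXiv v5 p. 9); p. 10] [cite: Kesten1963SAW, Section 4] [cite: MadrasSlade1993, Section 4.2, (4.2.4), Theorem 4.2.2 (pp. 91–92)] -/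
theorem tendsto_pow_eight_mul_wallRate_sq_sub :
    Tendsto (fun y : ℝ => y ^ 8 * (wallRate y ^ 2 - y - 1 / y - 1 / y ^ 2 - 2 / y ^ 3 - 4 / y ^ 4 - 6 / y ^ 5 - 12 / y ^ 6 - 18 / y ^ 7))
      atTop (𝓝 15) := by
  classical
  have h := tendsto_pow_eight_mul_wallRate_sq_sub_census (m₁ := 20) (m₂ := 22) (m₃ := 24) (m₄ := 26) rfl rfl rfl rfl
  rw [card_oneVisit_ipwb_twenty_eq_twoSixtySeven rfl, card_twoVisit_ipwb_twentytwo_eq rfl, card_threeVisit_ipwb_twentyfour_eq rfl,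
    card_fourVisit_ipwb_twentysix_eq rfl] at h
  exact tendsto_of_tendsto_of_eq_nx h (by norm_num)

/-- ★★★ The same in Landau form: `β(y)² − (y + 1/y + 1/y² + 2/y³ + 4/y⁴ + 6/y⁵ + 12/y⁶ + 18/y⁷ + 15/y⁸) = o(y⁻⁸)` as `y → ∞`.
[cite: BeatonBousquetMelouDeGierDuminilCopinGuttmann2014, Section 3.1, Proposition 5 (arXiv v5 p. 9)] -/
theorem isLittleO_wallRate_sq_sub_ninth :
    (fun y : ℝ => wallRate y ^ 2 - (y + 1 / y + 1 / y ^ 2 + 2 / y ^ 3 + 4 / y ^ 4 + 6 / y ^ 5 + 12 / y ^ 6 + 18 / y ^ 7 + 15 / y ^ 8)) =o[atTop]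
      fun y : ℝ => 1 / y ^ 8 := by
  have h0 : Tendsto (fun y : ℝ => y ^ 8 * (wallRate y ^ 2 - y - 1 / y - 1 / y ^ 2 - 2 / y ^ 3 - 4 / y ^ 4 - 6 / y ^ 5 - 12 / y ^ 6 - 18 / y ^ 7) - 15)
      atTop (𝓝 0) := by
    simpa using tendsto_pow_eight_mul_wallRate_sq_sub.sub_const 15
  have h1 : (fun y : ℝ => y ^ 8 * (wallRate y ^ 2 - y - 1 / y - 1 / y ^ 2 - 2 / y ^ 3 - 4 / y ^ 4 - 6 / y ^ 5 - 12 / y ^ 6 - 18 / y ^ 7) - 15) =o[atTop]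
      fun _ : ℝ => (1 : ℝ) := (isLittleO_one_iff ℝ).2 h0
  have h2 := h1.mul_isBigO (isBigO_refl (fun y : ℝ => 1 / y ^ 8) atTop)
  refine (h2.congr' ?_ ?_)
  · filter_upwards [eventually_gt_atTop (0 : ℝ)] with y hy
    field_simp
    ring
  · exact Eventually.of_forall fun y => by simp

/-- ★★ Two-sided eventual form: for every `δ > 0`, eventually
`y + 1/y + 1/y² + 2/y³ + 4/y⁴ + 6/y⁵ + 12/y⁶ + 18/y⁷ + (15 − δ)/y⁸ ≤ β(y)² ≤ y + 1/y + 1/y² + 2/y³ + 4/y⁴ + 6/y⁵ + 12/y⁶ + 18/y⁷ + (15 + δ)/y⁸`.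
[cite: BeatonBousquetMelouDeGierDuminilCopinGuttmann2014, Section 3.1, Proposition 5 (arXiv v5 p. 9)] -/
theorem eventually_ninth_order_window {δ : ℝ} (hδ : 0 < δ) :
    ∀ᶠ y : ℝ in atTop, y + 1 / y + 1 / y ^ 2 + 2 / y ^ 3 + 4 / y ^ 4 + 6 / y ^ 5 + 12 / y ^ 6 + 18 / y ^ 7 + (15 - δ) / y ^ 8 ≤ wallRate y ^ 2 ∧
      wallRate y ^ 2 ≤ y + 1 / y + 1 / y ^ 2 + 2 / y ^ 3 + 4 / y ^ 4 + 6 / y ^ 5 + 12 / y ^ 6 + 18 / y ^ 7 + (15 + δ) / y ^ 8 := by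
  have h := tendsto_pow_eight_mul_wallRate_sq_sub
  have hlo := h.eventually (eventually_gt_nhds (show (15 : ℝ) - δ < 15 by linarith))
  have hhi := h.eventually (eventually_lt_nhds (show (15 : ℝ) < 15 + δ by linarith))
  filter_upwards [hlo, hhi, eventually_gt_atTop (0 : ℝ)] with y h1 h2 hy
  have hy8 : 0 < y ^ 8 := pow_pos hy 8
  have e2 : wallRate y ^ 2 = (y + 1 / y + 1 / y ^ 2 + 2 / y ^ 3 + 4 / y ^ 4 + 6 / y ^ 5 + 12 / y ^ 6 + 18 / y ^ 7) +
      (y ^ 8 * (wallRate y ^ 2 - y - 1 / y - 1 / y ^ 2 - 2 / y ^ 3 - 4 / y ^ 4 - 6 / y ^ 5 - 12 / y ^ 6 - 18 / y ^ 7)) / y ^ 8 := by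
    field_simp
    ring
  have elo : y + 1 / y + 1 / y ^ 2 + 2 / y ^ 3 + 4 / y ^ 4 + 6 / y ^ 5 + 12 / y ^ 6 + 18 / y ^ 7 + (15 - δ) / y ^ 8 =
      (y + 1 / y + 1 / y ^ 2 + 2 / y ^ 3 + 4 / y ^ 4 + 6 / y ^ 5 + 12 / y ^ 6 + 18 / y ^ 7) + (15 - δ) / y ^ 8 := by ring
  have ehi : y + 1 / y + 1 / y ^ 2 + 2 / y ^ 3 + 4 / y ^ 4 + 6 / y ^ 5 + 12 / y ^ 6 + 18 / y ^ 7 + (15 + δ) / y ^ 8 =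
      (y + 1 / y + 1 / y ^ 2 + 2 / y ^ 3 + 4 / y ^ 4 + 6 / y ^ 5 + 12 / y ^ 6 + 18 / y ^ 7) + (15 + δ) / y ^ 8 := by ring
  rw [elo, ehi, e2]
  constructor
  · gcongr
  · gcongr

/-- ★ Uniqueness form: any limit of `y⁸ (β(y)² − y − 1/y − 1/y² − 2/y³ − 4/y⁴ − 6/y⁵ − 12/y⁶ − 18/y⁷)` equals `15`. [cite: MadrasSlade1993, Section 4.2, Theorem 4.2.2 (pp. 91–92)] -/
theorem tendsto_pow_eight_mul_wallRate_sq_sub_unique {L : ℝ}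
    (h : Tendsto (fun y : ℝ => y ^ 8 * (wallRate y ^ 2 - y - 1 / y - 1 / y ^ 2 - 2 / y ^ 3 - 4 / y ^ 4 - 6 / y ^ 5 - 12 / y ^ 6 - 18 / y ^ 7))
      atTop (𝓝 L)) :
    L = 15 :=
  tendsto_nhds_unique h tendsto_pow_eight_mul_wallRate_sq_sub

/-- ★★ **The strong-adsorption expansion of `β²` through order nine is not monotone in its coefficients**: `a₈ = 15 < 18 = a₇` — the first decrease
(`1, 1, 2, 4, 6, 12, 18, 15`). [cite: BeatonBousquetMelouDeGierDuminilCopinGuttmann2014, Section 3.1, Proposition 5 (arXiv v5 p. 9); p. 10] -/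
theorem ninth_coefficient_lt_eighth {L₇ L₈ : ℝ}
    (h₇ : Tendsto (fun y : ℝ => y ^ 7 * (wallRate y ^ 2 - y - 1 / y - 1 / y ^ 2 - 2 / y ^ 3 - 4 / y ^ 4 - 6 / y ^ 5 - 12 / y ^ 6)) atTop (𝓝 L₇))
    (h₈ : Tendsto (fun y : ℝ => y ^ 8 * (wallRate y ^ 2 - y - 1 / y - 1 / y ^ 2 - 2 / y ^ 3 - 4 / y ^ 4 - 6 / y ^ 5 - 12 / y ^ 6 - 18 / y ^ 7))
      atTop (𝓝 L₈)) : L₈ < L₇ := by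
  rw [tendsto_pow_seven_mul_wallRate_sq_sub_unique h₇, tendsto_pow_eight_mul_wallRate_sq_sub_unique h₈]
  norm_num

end Literature.Probability.RandomPlanarGeometry.SAW.HexBW.Wall
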